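import Summits.ResolutionOfSingularities.ResolutionOfSingularities.Theorems.MarkedTransferCampaignW46ThreefoldsGammaFreeGlobal
import Literature.AlgebraicGeometry.Resolution.EmbeddedCurvePointBlowups
import Literature.AlgebraicGeometry.Resolution.OrderSemicontinuityPointwise
import Literature.AlgebraicGeometry.Resolution.BlowupOffCentre
import Literature.AlgebraicGeometry.Resolution.PointCentrePermissible
import Literature.AlgebraicGeometry.Resolution.AlterationsProofs
import Literature.AlgebraicGeometry.Resolution.AlterationsResolution
import HarnessLib

/-!
# [OURS · L1 W4.6 rung (ii), dimension ladder] PERMISSIBLE EMBEDDED RESOLUTION OF A CURVE LYING IN THE ORDER-`≥ m`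
# LOCUS (brick B4 of rung (ii-2) `GammaFreeGlobalOrderReductionDimLE p 2`; any ambient dimension)

Cell res-hironaka, LADDER-RESOLUTION rung L (D-0089), slot W4.6 «restricted-regime rungs of the typed Th. 16.6 procedure»,
rung (ii) (dimension ladder of res-L1-type-o1's `…GammaFreeGlobalLadder.lean` p496755, RUNG-MAP-W46.md (ii-2)); seat
res-D-pv-049 AS res-L1-s46-pv-11 (holder of rung (ii-2), res-plan-2 D→L MAP v1.6 (3)). Host route MarkedTransfer, host
item `HypersurfaceOrderReductionDimLeThree` (stmt-ResolutionOfSingularities-16156); this file is proposed `--kind proof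
--supports` it `--as helper`. Everything here is OURS scheme theory over the tree's blow-up library; nothing of
H. Hironaka's manuscript [Hironaka2017] is asserted (its Def. 2.4 p.6 / §2.1 p.4 «permissible» enter only through the
campaign predicate `CampaignW46.IsPermissibleBlowupSeq`, scope only). AI-written; AI review is weaker than expert review.

## What is proved (brick B4 of the d = 2 plan posted on STATUS 2026-08-27T04:57:59Z, usable in every ambient dimension)

`CampaignW46.exists_isPermissibleBlowupSeq_embeddedResolution` — **permissible embedded resolution of ONE integral curve
inside `Sing(J, m)`**. Let `X` be a regular locally Noetherian scheme, `J` an ideal sheaf on `X`, `m : ℕ`, and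
`i : C ↪ X` a closed immersion of an integral Noetherian quasi-excellent scheme `C` of dimension `≤ 1` whose generic point
`η` satisfies `m ≤ ord_{i(η)} J` (for a prime divisor `C` of a hypersurface ideal on a surface: «the component `C` has
multiplicity `≥ m`»). Then there are a SEQUENCE OF PERMISSIBLE BLOWING-UPS `Φ : X′ → X` for `(J, m)` in the sense of
`CampaignW46.IsPermissibleBlowupSeq` (regular centres inside the successive loci `{ord ≥ m}` of the WHOLE stages, no
localisation) with last transform `J′`, which is at the same time a composition of blowing ups at CLOSED POINTS lying over
the singular locus of `C` (`IsPointBlowupComposition`), a closed immersion `i′ : C′ ↪ X′` of a REGULAR integral scheme and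
a proper birational `ρ : C′ → C` with `i′ ≫ Φ = ρ ≫ i` (the iterated strict transform of `C`), such that
`m ≤ ord_{i′(c′)} J′` at every point of `C′` and `ord_{i′(η′)} J′ = ord_{i(η)} J` at the generic point.

PROOF = the tree's `exists_embeddedResolution_of_curve` (Liu 2002 Lemma 9.2.32 = Cossart–Piltant 2008 proof of Prop. 4.8,
device 2-: well-founded induction on `Σ_y δ(𝒪_{C,y})`, one blowing up at a singular closed point at a time, the strict
transform mapped into the blow-up by the universal property) RE-RUN WITH THE CONTROLLED TRANSFORM THREADED THROUGH:
* each centre `x = i(c)` is PERMISSIBLE for the current transform — `ord_{i(η)} J ≥ m` spreads from the generic point to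
  every point of `C = cl{η}` because on a regular scheme the order does not decrease under specialisation
  (`idealOrder_le_of_specializes`, Cossart–Piltant 2008 proof of Prop. 4.2);
* the hypothesis propagates to the strict transform: its generic point `η₁` lies over `η ≠ x`, hence off the centre,
  where the controlled transform has the same order as `J` (`IsBlowup.idealOrder_controlledTransform_of_not_mem`), and
  `ρ₁ η₁ = η` because `ρ₁` is birational hence dominant (`IsBirational.isDominant`, `genericPoint_eq_of_isDominant`);
* the steps compose (`IsPermissibleBlowupSeq.single` / `.comp`), all stages stay regular and locally Noetherian
  (`IsPermissibleBlowupSeq.isLocallyNoetherian_and_isRegular`, Liu 8.1.19 (a)).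

ROLE IN RUNG (ii-2) (surfaces): this is move «make a component of multiplicity `n_C ≥ m` regular by point blow-ups, all
of them permissible» of the order-reduction loop; once `C′` is regular it is an effective Cartier centre inside
`Sing(J′, m)` and res-D-pv-047's brick B1 (`…GammaFreeGlobalCartierStep.lean`) divides `J′` by `𝓘_{C′}^m`.
The statement is dimension-free so that rung (ii-3) (`d = 3`) can reuse it for curve components of `Sing(J, m)`.

## Sources

* Q. Liu, *Algebraic Geometry and Arithmetic Curves* (2002), §9.2.4 Lemma 2.32; §8.1 Prop. 1.26, Thm. 8.1.19 (a).
  [Liu2002]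
* V. Cossart, O. Piltant, J. Algebra 320 (2008) 1051–1082, proofs of Prop. 4.2 (upper semicontinuity of the order)
  and Prop. 4.8 (device 2-, «the minimal composition of point blowing ups making the strict transform regular»).
  [CossartPiltant2008]
* H. Hironaka, ms. 2017-03-23, §2.1 p.4, Def. 2.1 p.5, Def. 2.4 p.6 — scope only, under adjudication, not cited as fact.
  [Hironaka2017]
-/

noncomputable section

set_option linter.dupNamespace false -- mandated namespace of this single-conjunct summit

open CategoryTheory AlgebraicGeometry TopologicalSpace IsLocalRing

namespace Summit.ResolutionOfSingularities.ResolutionOfSingularities.Theorems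

namespace CampaignW46

open Literature.AlgebraicGeometry.Resolution
open Scheme.IdealSheafData
open Literature.AlgebraicGeometry.Hironaka2017

universe u

/-! ## Two small facts about orders and generic points -/

/-- On a regular scheme, a lower bound for the order of `J` at the image of the GENERIC point of an integral scheme
`C → X` holds at the image of EVERY point of `C` (the order does not decrease under specialisation,
`idealOrder_le_of_specializes`). [cite: CossartPiltant2008, Prop. 4.2 (proof)] -/
theorem le_idealOrder_apply_of_le_idealOrder_genericPoint {X C : Scheme.{u}} (hX : Scheme.IsRegular X)
    (i : C ⟶ X) [IsIntegral C] (J : X.IdealSheafData) {n : ℕ∞}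
    (hn : n ≤ idealOrder J (i (genericPoint C))) (c : C) : n ≤ idealOrder J (i c) := by
  haveI := hX (i c)
  exact hn.trans (idealOrder_le_of_specializes ((genericPoint_specializes c).map i.continuous) J)

/-- A proper birational morphism of integral schemes maps the generic point to the generic point (it is dominant).
[folklore] -/
theorem apply_genericPoint_of_isBirational {C' C : Scheme.{u}} [IsIntegral C'] [IsIntegral C] {ρ : C' ⟶ C}
    (hρ : IsBirational ρ) : ρ (genericPoint C') = genericPoint C := by
  haveI := hρ.isDominant
  exact genericPoint_eq_of_isDominant ρ

/-! ## The brick -/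

/-- **[OURS · W4.6 rung (ii-2), brick B4] Permissible embedded resolution of an integral curve lying in `Sing(J, m)`.**
For a regular locally Noetherian scheme `X`, an ideal sheaf `J`, `m : ℕ`, and a closed immersion `i : C ↪ X` of an
integral Noetherian quasi-excellent scheme `C` of dimension `≤ 1` with `m ≤ ord_{i(η_C)} J`: there are a sequence of
permissible blowing-ups `Φ : X′ → X` for `(J, m)` with last transform `J′` (`CampaignW46.IsPermissibleBlowupSeq`, the
campaign's localisation-free Def.-2.4 predicate — replaces the role of «a finite sequence of permissible blowups» of
Rem. 2.6 p.6; NOT a statement of the manuscript), which is a composition of blowing ups at closed points over the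
singular locus of `C`; a closed immersion `i′ : C′ ↪ X′` of a regular integral scheme; a proper birational `ρ : C′ → C`
with `i′ ≫ Φ = ρ ≫ i`; and `m ≤ ord_{i′(c′)} J′` for every `c′ : C′`, with `ord_{i′(η′)} J′ = ord_{i(η_C)} J` at the
generic point `η′` of `C′`. Proof: Liu 9.2.32 (`exists_embeddedResolution_of_curve`) with the controlled transform
threaded through the induction on `Σ δ`; permissibility of each point centre by `idealOrder_le_of_specializes`;
propagation by `IsBlowup.idealOrder_controlledTransform_of_not_mem` at the generic point of the strict transform.
[cite: Liu2002, §9.2.4 Lemma 2.32] [cite: CossartPiltant2008, proof of Prop. 4.8 (device 2-), p. 15] -/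
theorem exists_isPermissibleBlowupSeq_embeddedResolution {X C : Scheme.{u}} [IsLocallyNoetherian X]
    (hX : Scheme.IsRegular X) (i : C ⟶ X) [IsClosedImmersion i] [IsIntegral C] [IsNoetherian C]
    (hC : Scheme.IsQuasiExcellent C) (hdim : topologicalKrullDim C ≤ 1)
    (J : X.IdealSheafData) (m : ℕ) (hm : (m : ℕ∞) ≤ idealOrder J (i (genericPoint C))) :
    ∃ (X' C' : Scheme.{u}) (Φ : X' ⟶ X) (J' : X'.IdealSheafData) (i' : C' ⟶ X') (ρ : C' ⟶ C),
      IsPermissibleBlowupSeq J m Φ J' ∧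
      IsPointBlowupComposition (i '' (Scheme.regularLocus C)ᶜ) Φ ∧
      IsClosedImmersion i' ∧ i' ≫ Φ = ρ ≫ i ∧ IsIntegral C' ∧ Scheme.IsRegular C' ∧
      IsProper ρ ∧ IsBirational ρ ∧
      (∀ c' : C', (m : ℕ∞) ≤ idealOrder J' (i' c')) ∧
      ∀ η' : C', IsGenericPoint η' Set.univ → idealOrder J' (i' η') = idealOrder J (i (genericPoint C)) := by
  -- well-founded induction on `n = Σ δ ∈ ℕ∞`, over all ambient schemes, curves and ideal sheaves at once
  suffices H : ∀ (n : ℕ∞) {X C : Scheme.{u}} [IsLocallyNoetherian X], Scheme.IsRegular X → ∀ (i : C ⟶ X)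
      [IsClosedImmersion i] [IsIntegral C] [IsNoetherian C], Scheme.IsQuasiExcellent C →
      topologicalKrullDim C ≤ 1 → ∀ (J : X.IdealSheafData), (m : ℕ∞) ≤ idealOrder J (i (genericPoint C)) →
      ∑ᶠ y, pointDelta C y = n →
      ∃ (X' C' : Scheme.{u}) (Φ : X' ⟶ X) (J' : X'.IdealSheafData) (i' : C' ⟶ X') (ρ : C' ⟶ C),
        IsPermissibleBlowupSeq J m Φ J' ∧
        IsPointBlowupComposition (i '' (Scheme.regularLocus C)ᶜ) Φ ∧
        IsClosedImmersion i' ∧ i' ≫ Φ = ρ ≫ i ∧ IsIntegral C' ∧ Scheme.IsRegular C' ∧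
        IsProper ρ ∧ IsBirational ρ ∧
        (∀ c' : C', (m : ℕ∞) ≤ idealOrder J' (i' c')) ∧
        ∀ η' : C', IsGenericPoint η' Set.univ →
          idealOrder J' (i' η') = idealOrder J (i (genericPoint C)) from
    H _ hX i hC hdim J hm rfl
  intro n
  induction n using WellFoundedLT.induction with
  | _ n ih =>
  intro X C _ hX i _ _ _ hC hdim J hm hn
  classical
  by_cases hreg : Scheme.IsRegular C
  · -- no blowing up: `X′ = X`, `J′ = J`, `C′ = C`
    refine ⟨X, C, 𝟙 X, J, i, 𝟙 C, IsPermissibleBlowupSeq.nil, IsPointBlowupComposition.nil, inferInstance,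
      by simp, inferInstance, hreg, inferInstance,
      ⟨⊤, by simp [dense_univ], by simp [dense_univ], inferInstance⟩,
      fun c => le_idealOrder_apply_of_le_idealOrder_genericPoint hX i J hm c, fun η' hη' => ?_⟩
    rw [hη'.eq (genericPoint_spec C)]
  -- a singular point `c`, closed, with `dim 𝒪_{C,c} = 1`, `𝒪_{C,c}` not a DVR
  obtain ⟨c, hc⟩ : ∃ c, c ∉ Scheme.regularLocus C := not_forall.mp hreg
  have hcl : IsClosed ({c} : Set C) :=
    isClosed_singleton_of_not_mem_regularLocus_of_dim_le_one hC hdim hc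
  obtain ⟨h1, hsing⟩ :=
    ringKrullDim_eq_one_and_not_isDiscreteValuationRing_of_not_mem_regularLocus hdim hc
  have hcf : ¬ IsField (C.presheaf.stalk c) :=
    (ringKrullDim_eq_one_iff_of_isLocalRing_isDomain.mp h1).1
  -- the closed point `x = i(c)` of `X`, not the whole of `X`, and not the image of the generic point
  obtain ⟨x, hcx⟩ : ∃ x : X, i c = x := ⟨_, rfl⟩
  have hx : IsClosed ({x} : Set X) := by
    rw [← hcx, ← Set.image_singleton]
    exact i.isClosedEmbedding.isClosedMap _ hcl
  have hηx : i (genericPoint C) ≠ x := by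
    rw [← hcx]
    exact fun h => ne_genericPoint_of_not_mem_regularLocus hc (i.isClosedEmbedding.injective h).symm
  have hxne : ({x} : Set X) ≠ Set.univ := by
    intro h
    have hmem : i (genericPoint C) ∈ ({x} : Set X) := h ▸ Set.mem_univ _
    exact hηx (Set.mem_singleton_iff.mp hmem)
  -- the centre `{x}` is PERMISSIBLE for `(J, m)`: regular, and of order `≥ m` (spread from the generic point of `C`)
  have hDreg : Scheme.IsRegular (vanishingIdeal (⟨{x}, hx⟩ : Closeds X)).subscheme :=
    isRegular_subscheme_vanishingIdeal_singleton hx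
  have hD : ∀ y ∈ ((⟨{x}, hx⟩ : Closeds X) : Set X), (m : ℕ∞) ≤ idealOrder J y := by
    intro y hy
    obtain rfl : y = x := hy
    rw [← hcx]
    exact le_idealOrder_apply_of_le_idealOrder_genericPoint hX i J hm c
  -- blow up `X` at `x` (one permissible step), and `C` along `i⁻¹𝓘_{x} 𝒪_C` (the strict transform)
  obtain ⟨X₁, π₁, hπ₁⟩ := exists_isBlowup X (vanishingIdeal ⟨{x}, hx⟩)
  have hstep : IsPermissibleBlowupSeq J m π₁ (controlledTransform π₁ (vanishingIdeal ⟨{x}, hx⟩) J m) :=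
    IsPermissibleBlowupSeq.single _ π₁ hDreg hD hπ₁
  set J₁ : X₁.IdealSheafData := controlledTransform π₁ (vanishingIdeal ⟨{x}, hx⟩) J m with hJ₁
  obtain ⟨hN₁, hX₁⟩ := hstep.isLocallyNoetherian_and_isRegular inferInstance hX
  haveI := hN₁
  obtain ⟨C₁, ρ₁, hρ₁⟩ := exists_isBlowup C ((vanishingIdeal ⟨{x}, hx⟩).comap i)
  haveI : IsIntegral C₁ := hρ₁.isIntegral_strictTransform i hx hcx hcf
  obtain ⟨hN₁C, hC₁⟩ := hρ₁.isLocallyNoetherian_and_isQuasiExcellent_strictTransform i hx hC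
  haveI := hN₁C
  haveI : IsProper ρ₁ := hρ₁.isProper
  haveI : CompactSpace C₁ := QuasiCompact.compactSpace_of_compactSpace ρ₁
  haveI : IsNoetherian C₁ := {}
  have hdim₁ : topologicalKrullDim C₁ ≤ 1 := hρ₁.topologicalKrullDim_le hdim
  have hlt : ∑ᶠ y, pointDelta C₁ y < n :=
    hn ▸ (hρ₁.finsum_pointDelta_strictTransform_lt i hx hcx hC hdim h1 hsing).2
  have hbir₁ : IsBirational ρ₁ := hρ₁.isBirational' (comap_vanishingIdeal_singleton_ne_bot i hx hcx hcf)
  -- the strict transform as a closed subscheme of `X₁` (universal property + GW 13.96 (2))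
  let j : C₁ ⟶ X₁ := hπ₁.lift (ρ₁ ≫ i)
    (by rw [Scheme.IdealSheafData.comap_comp]; exact hρ₁.isEffectiveCartier)
  have hj : j ≫ π₁ = ρ₁ ≫ i := hπ₁.lift_comp _ _
  haveI : IsClosedImmersion j := hπ₁.isClosedImmersion_of_comp_eq hρ₁ hj
  -- the generic point of the strict transform lies over `i(η) ≠ x`: the order of the transform there is that of `J`
  have hπj : π₁ (j (genericPoint C₁)) = i (genericPoint C) := by
    rw [← Scheme.Hom.comp_apply, hj, Scheme.Hom.comp_apply, apply_genericPoint_of_isBirational hbir₁]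
  have hnot : π₁ (j (genericPoint C₁)) ∉ ((vanishingIdeal (⟨{x}, hx⟩ : Closeds X)).support : Set X) := by
    rw [coe_support_vanishingIdeal, hπj]
    exact fun h => hηx (Set.mem_singleton_iff.mp h)
  have hgen₁ : idealOrder J₁ (j (genericPoint C₁)) = idealOrder J (i (genericPoint C)) := by
    rw [hJ₁, hπ₁.idealOrder_controlledTransform_of_not_mem J m hnot, hπj]
  have hm₁ : (m : ℕ∞) ≤ idealOrder J₁ (j (genericPoint C₁)) := by
    rw [hgen₁]
    exact hm
  -- induction
  obtain ⟨X', C', Φ', J', i', ρ', hseq', hπ', hi', hsq, hint, hreg', hρ', hbir', hge', hgen'⟩ :=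
    ih _ hlt hX₁ j hC₁ hdim₁ J₁ hm₁ rfl
  refine ⟨X', C', Φ' ≫ π₁, J', i', ρ' ≫ ρ₁, hstep.comp hseq', ?_, hi', ?_, hint, hreg', inferInstance,
    hbir'.comp hbir₁, hge', fun η' hη' => (hgen' η' hη').trans hgen₁⟩
  · -- the centres lie over singular points of `C`
    have h₁ : IsPointBlowupComposition (i '' (Scheme.regularLocus C)ᶜ) π₁ :=
      IsPointBlowupComposition.single π₁ x hx hxne ⟨c, hc, hcx⟩ hπ₁
    refine h₁.comp ?_ hπ'
    rintro _ ⟨_, ⟨y', hy', rfl⟩, rfl⟩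
    refine ⟨ρ₁ y', hρ₁.not_mem_regularLocus_of_strictTransform
      (support_comap_vanishingIdeal_singleton i hx hcx) hc hy', ?_⟩
    rw [← Scheme.Hom.comp_apply, ← hj, Scheme.Hom.comp_apply]
  · rw [← Category.assoc, hsq, Category.assoc, hj, Category.assoc]

end CampaignW46

end Summit.ResolutionOfSingularities.ResolutionOfSingularities.Theorems

end
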